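import Literature.NumberTheory.EllipticCurves.AnticyclotomicSignedSelmer
import Literature.NumberTheory.EllipticCurves.LambdaAdicSelmerDataProofs
import HarnessLib

/-!
# The COMPACT signed (plus/minus) anticyclotomic Selmer carriers at a supersingular prime with
# `a_p = 0`: the finite-level signed conditions with torsion coefficients `ℋ^±_{n,v}[p^m]`
# (Hatley–Lei–Vigni), Castella–Wan's nine compact Selmer groups `Sel^{𝓛}(K_n, E[p^m])`,
# `Sel^{𝓛}(K_n, T) = lim←_m`, and the `Λ^ac`-adic modules `Sel^{𝓛}(K, 𝐓^ac) = lim←_n` (CONSTRUCTED),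
# with Hatley–Lei–Vigni's Lemma 3.7 / Prop. 3.9 as named facts

Topic `Literature/NumberTheory/EllipticCurves`; namespace `Literature.NumberTheory.EllipticCurves.AcSigned`
(continuing the object namespace of `AnticyclotomicSignedSelmer.lean`, whose DISCRETE carriers —
`signedKummerInfty`, `condAbove`, the nine groups `selmer W p κ Σ 𝓛 ≤ H¹(K_∞, E[p^∞])`, their duals
`X` — this file complements on the COMPACT side). Cell `pub/bsd-wall` (rung W-ALL of the BSD summit),
literature-typer seat `bsd-wall-utd-ty1` (successor generation; director-bsd g12 (142)(e)),
`--supports` stmt-BirchSwinnertonDyer-23594 = crux `TwinSplitIMCAtThreeGoodSSApZero` of the route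
`UniversalToricDescent` (its `⊇`/Howard half is a PORT to `p = 3`, `a_3 = 0` of Castella–Wan's
"signed Heegner classes `z^±_∞ ∈ Sel_±(K, 𝐓^ac)` + Kolyvagin system + explicit reciprocity law ⟹
`char_{Λac}(X^{rel,str}) Λ^ur ⊃ (L_p^BDP)`", journal Thm. A.5 + Thm. 6.8 (6.12)–(6.15); the previous
generation recorded "COMPACT signed carriers NOT typed" as the honest gap). HONEST FRAMING:
DEFINITIONS with bodies + PROVED structural lemmas + a CONSTRUCTED `ℤ_p⟦T⟧`-module structure (a `def`,
no instance, no hypothesis structure) + TWO statement-only named facts (`def … : Prop`, D-0014,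
hypotheses as printed, specialised as documented; nothing asserted, no `_holds`). Typed ≠ proved ≠
endorsed; BSD is not advanced by this file; the crux stays open.

## What is typed here (and the one mathematical point that dictates the design)

Castella–Wan's compact signed Selmer group is `Sel_±(K, 𝐓^ac) = ker{H¹(K, 𝐓^ac) → ∏_v H¹(K_v, 𝐓^ac)/
H¹_{𝓕±}(K_v, 𝐓^ac)}` ((4.7)), `H¹(K, 𝐓^ac) ≃ lim←_n H¹(K^ac_n, T)` (Shapiro, as in (3.10), §4.1), with
`H¹_{𝓕±} = H¹_±(K_v, 𝐓^ac) ≃ lim←_m H¹_±(K^ac_{m,v₁}, T)` above `p` (§6.1) and `H¹(K_v, 𝐓^ac)` (no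
condition) at `v ∤ p`; `H¹_±(k, T)` is "the orthogonal complement of `E^±(k) ⊗ ℚ_p/ℤ_p`" under the
local Tate pairing (Def. 3.6). Hatley–Lei–Vigni work instead, at every finite layer `K_n` and with
torsion coefficients `A_m = E[p^m] = T/p^m`, with `ℋ^±_{n,v} := (ℋ^±_v)^{Gal(K_{∞,v}/K_{n,v})}`,
`ℋ^±_v := ⋃_n Ê^±(K_{n,v}) ⊗ ℚ_p/ℤ_p` ((3.1)), and prove (Prop. 3.2 (b), after B.-D. Kim) that
`ℋ^±_{n,v}[p^m] ⊂ H¹(K_{n,v}, A_m)` IS ITS OWN EXACT ANNIHILATOR — so ONE finite-level condition serves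
the discrete side (`lim→`) and the compact side (`lim←`), and `lim←_{n}` of these conditions is
Castella–Wan's `H¹_±(K_v, 𝐓^ac)` (for `x = (x_n) ∈ lim← H¹(K_{n,v}, T)`: `x_n ⊥ ℋ^±_{n,v}` for all `n`
iff `x_n ⊥ E^±(K_{n,v}) ⊗ ℚ_p/ℤ_p` for all `n`, since `⟨cor x_{n'}, y⟩_n = ⟨x_{n'}, res y⟩_{n'}` and
every element of `ℋ^±_{n,v}` comes from some `E^±(K_{n',v}) ⊗ ℚ_p/ℤ_p`). Their Remark 3.5: these
finite-level groups differ from Kobayashi's / Iovita–Pollack's "unless the base field is `K_0 = K` or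
`K_∞`"; indeed `ℋ^±_{n,v}[p^m]` and the classical `E(K_{n,v})/p^m` are both maximal isotropic of the
same order, so NEITHER contains the other for `n ≥ 1` — whereas in the limits `Sel_±(K, 𝐀^ac) ⊂
Sel_{p^∞}(E/K^ac_∞)` and `Sel(K^ac_∞, T) ⊂ Sel_±(K, 𝐓^ac)` (Castella–Wan, MS p. 15: "`Ê(𝔪) ⊗ ℤ_p =
(Ê(𝔪) ⊗ ℚ_p/ℤ_p)^⊥ ⊂ (Ê^±(𝔪) ⊗ ℚ_p/ℤ_p)^⊥ = H¹_±(k, T)`"). CONSEQUENCE FOR THE TREE: the compact signed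
module is NOT a submodule of the classical `WeierstrassCurve.LambdaAdicSelmerData.S = lim←_n S_p(E/K_n)`
(home of `heegnerModule`, `Howard2004_thmB`); it is built here on its own, by the same construction.

1. (Part 1) `toInfty W p κ n m : H¹(K_n, E[p^m]) → H¹(K_∞, E[p^∞])` (restriction + `E[p^m] ↪ E[p^∞]`,
   one `resH1Hom`), `Γ_K`-equivariant (`toInfty_conjH1`) and compatible with restriction between
   layers (`toInfty_resOfLe`) — the map of Hatley–Lei–Vigni's Remark 3.1.
2. (Part 2) `condAboveTorsion W p κ v L n m ≤ H¹(K_n, E[p^m])` := pullback along `toInfty` of the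
   `K_∞`-level condition `AcSigned.condAbove W p κ v L` (`L ∈ {rel, sgn ε, str}` = `AcSigned.PCond`):
   for `L = sgn ε` the `ℋ^ε_{n,v}[p^m]`-condition (Hatley–Lei–Vigni Def. 3.4, B.-D. Kim 2013
   Def. 3.5), PROVED `Γ_K`-stable and restriction-stable; the classical conditions away from `p`
   `awayTorsionOver` (verbatim the `v ∤ p` and archimedean components of the tree's
   `WeierstrassCurve.selmerTorsionOver`); the nine groups **`selmerTorsion W p κ 𝓛 n m =
   Sel^{𝓛}_{p^m}(E/K_n)`** (Castella–Wan Def. 5.1 at finite level: `𝓛 v` at `v ∣ p`, classical away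
   from `p`), PROVED: `Γ_K`-stability (`conjH1_mem_selmerTorsion`), relaxation monotonicity
   (`selmerTorsion_le_of_rel`), `Sel_{p^m}(E/K_n) ≤ Sel^{rel,rel}_{p^m}(E/K_n)`
   (`selmerTorsionOver_le_selmerTorsion_rel`); the compact layer groups **`compactSelmerLayer W p κ 𝓛 n
   = Sel^{𝓛}(K_n, T) = lim←_m`** (`p_*`-compatible families, the shape of `compactSelmerOver`) with
   `S_p(E/K_n) ≤ Sel^{rel,rel}(K_n, T)`.
3. (Part 3) **`lambdaAdic W p κ γ C`**, the norm-compatible, `p_*`-compatible families in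
   `∏_n ∏_m H¹(K_n, E[p^m])` cut out by ANY family of level conditions `C`, with its `ℤ_p⟦T⟧`-module
   structure **`lambdaAdic.moduleOfGen hγ hC`** (`T ↦ conj_γ − 1` through the truncated evaluation
   `IwasawaDual.evalT`, legitimate since `(conj_γ − 1)^{m pⁿ} = 0` on `H¹(K_n, E[p^m])`; PROVED to
   preserve the families for `conj_γ`-stable `C`, `tsmul_mem`; module axioms from the `evalT` algebra
   — the construction of `LambdaAdicSelmerDataExists.nonempty_lambdaAdicSelmerData`, here as a `def`
   to be activated with `letI`, exactly as `AcSigned.X.moduleOfGen` on the discrete side), certified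
   by `lambdaAdic.smul_apply / X_smul_apply / C_smul_apply`; and **`selmerLambdaAdic W p κ γ 𝓛 =
   Sel^{𝓛}(K, 𝐓^ac) = lim←_n Sel^{𝓛}(K_n, T)`** with `selmerLambdaAdic.moduleOfGen hγ 𝓛`, the
   relaxation inclusions (`selmerLambdaAdic_le_of_rel`, the containments behind (6.12)–(6.13)), the
   BRIDGE `proj_mem_selmerLambdaAdic_rel` (every element of the classical datum `D.S` gives an
   element of `Sel^{rel,rel}(K, 𝐓^ac)`), and the predicates `selmerLambdaAdic.HasRank hγ 𝓛 r`,
   `selmerLambdaAdic.IsTorsion hγ 𝓛` in which Lemma 6.7 / Thm. 6.8 / Thm. A.5 speak.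
4. (Part 4) two NAMED FACTS usable AT `p = 3` (printed for odd `p`):
   `hatleyLeiVigni2022_lemma37_signedSelmerTorsion_zero` (`Sel^±_{p^m}(E/K) = Sel_{p^m}(E/K)`; the
   input "`Sel_+(K, T) = Š_p(E/K)`" of Castella–Wan (6.16)) and
   `hatleyLeiVigni2022_prop39_control_layers` (control between finite layers under (Tam)).
The signed Heegner classes `z^±_∞ ∈ Sel_±(K, 𝐓^ac)` (Castella–Wan Def. 4.5) and Thm. A.5 are typed on
these carriers in the sibling file `AnticyclotomicSignedHeegnerClasses.lean`.

## Sources, VERBATIM (texts read by this seat 2026-08-28; locators)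

* [CastellaWan2023] F. Castella, X. Wan, *Perrin-Riou's main conjecture for elliptic curves at
  supersingular primes*, Math. Ann. 389 (2024) 2595–2636 = authors' accepted MS
  `paper:url-7157bd4f7b88` (https://web.math.ucsb.edu/~castella/Perrin-Riou.pdf; journal p = MS p
  + 2594). §3 (MS p. 9): "an elliptic curve with good supersingular reduction at an ODD prime `p`
  with `a_p = 0`"; **Def. 3.6** (p. 13) "Let `H¹_±(k_{m,n}, T)` be the orthogonal complement of
  `E^±(k_{m,n}) ⊗ ℚ_p/ℤ_p` under `( , )_{m,n}`"; **(3.9)** `H¹_±(k_{m,n}, T) = ker(P^±_{m,n})`;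
  **(3.10)** "Shapiro's lemma yields an isomorphism `H¹(ℚ_p, 𝐓_𝔭) ≃ lim←_{m,n} H¹(k_{m,n}, T)`, where
  the limit is with respect to corestriction"; p. 15 "`Ê(𝔪_{m,n}) ⊗ ℤ_p = (Ê(𝔪_{m,n}) ⊗ ℚ_p/ℤ_p)^⊥ ⊂
  (Ê^±(𝔪_{m,n}) ⊗ ℚ_p/ℤ_p)^⊥ = H¹_±(k_{m,n}, T)`"; **(3.13)** `ω̃^∓_n H¹_±(k_{m,n}, T) =
  im(δ : Ê^±(𝔪_{m,n}) ⊗ ℤ_p → H¹(k_{m,n}, T))`. §4 (p. 17: `p > 3`): §4.1 p. 19 "`H¹(K, 𝐓̃) ≃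
  lim←_n H¹(K[p^n], T)` given by Shapiro's lemma", "we identify `Λ^ac` with the one variable power
  series ring `ℤ_p⟦Y⟧` setting `Y = γ^ac − 1`"; **Def. 4.6** (p. 21); p. 22: "`𝓕_±` … `H¹_±(K_v,
  𝐓^ac)` if `v ∣ p`, `H¹(K_v, 𝐓^ac)` if `v ∤ p`", **(4.7)** `Sel_±(K, 𝐓^ac) := ker{H¹(K, 𝐓^ac) → ∏_v
  H¹(K_v, 𝐓^ac)/H¹_{𝓕±}(K_v, 𝐓^ac)}`, "`𝐀^ac := T ⊗̂ Hom_{ℤ_p}(Λ^ac, ℚ_p/ℤ_p)` … `H¹_{𝓕±}(K_v, 𝐀^ac)`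
  … the orthogonal complement of `H¹_{𝓕±}(K_v, 𝐓^ac)` under local duality"; **Def. 5.1** (p. 23)
  "Let `M` denote either `𝐓^ac` or `𝐀^ac`. For `v ∈ {𝔭, 𝔭̄}` and `𝓛_v ∈ {rel, ±, str}`, set
  `H¹_{𝓛_v}(K_v, M) = H¹(K_v, M)` if `𝓛_v = rel`, `H¹_±(K_v, M)` if `𝓛_v = ±`, `0` if `𝓛_v = str` …
  `Sel^𝓛(K, M) := ker{H¹(K, M) → ∏_{v ∈ {𝔭,𝔭̄}} H¹(K_v, M)/H¹_{𝓛_v}(K_v, M) × ∏_{v ∤ p} H¹(K_v, M)/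
  H¹_{𝓕±}(K_v, M)}`"; §6.1 (p. 25) "`a^± = {a^±_m}_m ∈ lim←_m H¹_±(K^ac_{m,v₁}, T) ≃ H¹_±(K_v,
  𝐓^ac_{v₁})`"; **Lemma 6.7** (p. 28) "(1) `X_±` and `Sel_±(K, 𝐓^ac)` have the same `Λ^ac`-rank.
  (2) `rank X^{rel,±} = 1 + rank X^{±,str}` and `char(X^{rel,±}_tors) = char(X^{±,str}_tors)`";
  **Thm. 6.8** (p. 30) with **(6.12)** `0 → Sel^{str,rel}(K, 𝐓^ac) → Sel^{±,rel}(K, 𝐓^ac) —loc_𝔭→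
  H¹_±(K_𝔭, 𝐓^ac) → X^{rel,str} → X^{±,str} → 0`, **(6.13)**, "`Sel^{str,±}(K, 𝐓^ac) = 0`, since it is
  of `Λ^ac`-rank zero" (using "[PR00, §1.3.3] … the `Λ^ac`-torsion submodule of `H¹(K, 𝐓^ac)` is
  trivial"); §6.3 (p. 32) "`Sel_+(K, E[p^∞]) = Sel_{p^∞}(E/K)` and `Sel_+(K, T)` is identified with the
  pro-`p` Selmer group `Š_p(E/K) = lim←_m Sel_{p^m}(E/K)`", **(6.16)**.
* [HatleyLeiVigni2022] J. Hatley, A. Lei, S. Vigni, Manuscripta Math. 167 (2022), author TeX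
  `paper:arxiv-2003.10301`: §1.1 "`p` will denote an odd prime number. … good supersingular
  reduction at `p` and `a_p(E) = 0` … all the primes dividing `pN` split in `K` … totally ramified in
  `K_∞`"; **(3.1)** "`ℋ^±_v := ⋃_{n ≥ 0} Ê^±(K_{n,v}) ⊗ ℚ_p/ℤ_p`", "`ℋ^±_{n,v} := (ℋ^±_v)^{Gal(K_{∞,v}/
  K_{n,v})}`"; **Remark 3.1** "the natural maps `H¹(K_n, E[p^∞]) → H¹(K_{∞,v}, E[p^∞])^{𝒢_{∞/n}}` and
  `H¹(K_{n,v}, E[p^m]) → H¹(K_{n,v}, E[p^∞])[p^m]` are isomorphisms … we may identify `ℋ^±_{n,v}` and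
  `ℋ^±_{n,v}[p^m]` as submodules of `H¹(K_{n,v}, A)` and `H¹(K_{n,v}, A_m)`"; **Prop. 3.2** "(a) The
  `Λ`-module `(ℋ^±_v)^∨` is free of rank one. (b) Under the local Tate pairing `H¹(K_{n,v}, A_m) ×
  H¹(K_{n,v}, A_m) → ℤ/p^m ℤ`, the exact annihilator of `ℋ^±_{n,v}[p^m]` is `ℋ^±_{n,v}[p^m]`";
  **Def. 3.4** "`Sel^±_{p^m}(E/K_n) := ker(H¹_{S_n}(K_n, A_m) → ∏_{v ∈ S_n, v ∤ p} H¹(K_{n,v}, A_m)/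
  (E(K_{n,v})/p^m) × ∏_{v ∣ p} H¹(K_{n,v}, A_m)/ℋ^±_{n,v}[p^m])` … `Sel^±_{p^m}(E/K_∞) := lim→_n`";
  **Remark 3.5** "Our definitions are different from those in [IP] and [Kob], unless the base field is
  `K_0 = K` or `K_∞`. We have followed [Kim] because we would like our Selmer conditions at `p` to
  satisfy part (b) of Proposition 3.2"; **Lemma 3.7**, **Lemma 3.8**, **(Tam)**, **Prop. 3.9** (quoted
  at the facts).
* [BDKim2013] B. D. Kim, J. Aust. Math. Soc. 95 (2013), Def. 3.5 (p. 194): the finite-level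
  `±`-Selmer structure on `A_s` (the `K_∞`-level group seen at level `n`; "`:= 0` for `w ∤ p`").
* [PerrinRiou1987BSMF] §0 pp. 401–402 (`S_p(L) = lim← S(L)^{(p^n)}`, `𝔖_p(L)` along corestriction),
  the tree's `compactSelmerOver` / `LambdaAdicSelmerData`.

## READING FLAGS (informational — where the transcription is a reading, not a printed sentence)

* `CW24-local-condition` (inherited from `AnticyclotomicSignedSelmer.lean`): Castella–Wan DEFINE
  `H¹_±(K_v, 𝐓^ac)` as the `Γ ↠ Γ^ac`-image of the two-variable submodule (Def. 4.6) and USE the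
  anticyclotomic-tower presentation `lim←_m H¹_±(K^ac_{m,v₁}, T)` (§6.1); this file's condition is
  Hatley–Lei–Vigni's `ℋ^±_{n,v}[p^m]`, whose `lim←` agrees with the latter by Prop. 3.2 (b) and the
  corestriction/restriction adjunction (above) — an identification carried by the consumer, not a
  formalised step.
* `HLV-vs-Kob-layers`: at a finite layer `n ≥ 1` the condition `ℋ^±_{n,v}[p^m]` is neither
  Kobayashi's `E^±(K_{n,v})/p^m` nor the classical `E(K_{n,v})/p^m` (Remark 3.5); only at `n = 0`
  (Lemma 3.7, a named fact below) and after `lim` do the presentations meet. In particular NO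
  inclusion between `selmerTorsion … (sgn ε)` and the classical `selmerTorsionOver` is asserted or
  provable at `n ≥ 1`; `Sel(K^ac_∞, T) ⊂ Sel_±(K, 𝐓^ac)` holds in the limit (CW p. 15), not levelwise.
* `away-p-compact`: at places `w ∤ p` this file imposes the CLASSICAL condition levelwise (as
  `compactSelmerOver` and Hatley–Lei–Vigni Def. 3.4 do), whereas Castella–Wan's compact `𝓕_±` is no
  condition at `v ∤ p`. For `p_*`-compatible families the two agree: `lim←_m H¹(K_{n,w}, E[p^m]) =
  H¹(K_{n,w}, T) = E(K_{n,w}) ⊗ ℤ_p` for `w ∤ p` (the Tate module of the finite group `H¹(K_{n,w},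
  E)[p^∞]` vanishes), so every compatible local family is levelwise a Kummer class — a standard fact,
  not formalised here.
* `Shapiro`, `lim-m`: `H¹(K, 𝐓^ac) = lim←_n H¹(K_n, T)` and `H¹(K_n, T) = lim←_m H¹(K_n, E[p^m])`
  (Tate) are the docstring identifications under which `lambdaAdic` is `H¹_C(K, 𝐓^ac)` — the same
  ones the tree uses for `LambdaAdicSelmerData` ("`H¹_{F_Λ}(K, 𝐓) ∼ lim← S_p(E/K_n)`").
* `tot-ram-via-h_K`, `away-p` as in `AnticyclotomicSignedSelmer.lean`.

## NOT in this file (and why)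

* The local `Λ^ac`-adic carriers `H¹_±(K_v, 𝐓^ac)` themselves, the generators `a^±`, `Log^±_v`
  (Def. 6.1), the Coleman maps, Prop. 3.8 / 3.11, Thm. 6.2 (explicit reciprocity law), Cor. 6.4,
  Lemma 6.5 (control at height-one primes, [Kim07, Prop. 4.18]), the global-duality sequences
  (6.12)–(6.13) AS EXACT SEQUENCES, Thm. 6.8: they need local Iwasawa cohomology, the local Tate
  pairing and Poitou–Tate on the tree's `H¹`'s (none typed); printed for `p > 3` (§6) resp. odd `p`
  (§3) — recorded with locators as the ARCHITECTURE of the `p = 3` port. Hatley–Lei–Vigni Prop. 3.2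
  (a)/(b) likewise (pairing). Conj. 4.8 / 5.2 are conjectures (never Literature facts).
* No new hypothesis structure and no instance: the `Λ`-module structures are `def`s (`letI`).
-/

noncomputable section

open scoped Classical

open NumberField IsDedekindDomain Field
open Literature.NumberTheory.EllipticCurves Literature.NumberTheory.GaloisRepresentations
open Literature.NumberTheory.EllipticCurves.GreenbergSelmer
open Literature.NumberTheory.EllipticCurves.Kobayashi2003
open Literature.NumberTheory.EllipticCurves.IwasawaDual
open WeierstrassCurve (geomTorsion)
open WeierstrassCurve.LambdaAdicSelmerDataExists

universe u

namespace Literature.NumberTheory.EllipticCurves.AcSigned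

/-! ## Part 1. The maps `θ_{n,m} : H¹(K_n, E[p^m]) → H¹(K_∞, E[p^∞])` -/

section ToInfty

variable {K : Type u} [Field K] (W : WeierstrassCurve K) (p : ℕ) [Fact p.Prime]
  (κ : ZpExtension K p)

omit [Fact p.Prime] in
/-- `E[p^m] ⊆ E[p^∞] = ⋃_k E[p^k]` (`m`-th power of the integer `p`, the indexing of `torsionH1Over`/
`compactSelmerOver`; Greenberg: "`E[p^∞] = ⋃_n E[p^n]`"). [cite: GreenbergLNM1716, §1 (E[p^∞] = ⋃ E[p^n])] -/
theorem geomTorsion_zpow_le_geomPrimaryTorsion (m : ℕ) :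
    geomTorsion W ((p : ℤ) ^ m) ≤ W.geomPrimaryTorsion p := fun P hP ↦
  ⟨m, by
    have h := (WeierstrassCurve.mem_geomTorsion_iff W _ P).1 hP
    rwa [← Nat.cast_pow, natCast_zsmul] at h⟩

omit [Fact p.Prime] in
/-- Generic worker for `toInfty_comp_resOfLe`: for subgroups `H₁ ≤ H₂ ≤ H₃` of `Γ_K`, the composite
of `res_{H₂ → … } : H¹(H₃, E[p^m]) → H¹(H₂, E[p^m])` with the map `H¹(H₂, E[p^m]) → H¹(H₁, E[p^∞])`
induced by `(H₁ ↪ H₂, E[p^m] ↪ E[p^∞])` is the map induced by `(H₁ ↪ H₃, E[p^m] ↪ E[p^∞])`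
(functoriality of `H¹` in compatible pairs; stated for abstract subgroups so that the kernel check
is cheap). [cite: NeukirchSchmidtWingberg2008, I.§5] -/
theorem resH1Hom_inclusion_comp_resOfLe {H₁ H₂ H₃ : Subgroup (absoluteGaloisGroup K)}
    (h₁₂ : H₁ ≤ H₂) (h₂₃ : H₂ ≤ H₃) (m : ℕ) :
    (resH1Hom (N := W.geomPrimaryTorsion p) (subgroupInclusion h₁₂)
        (AddSubgroup.inclusion (geomTorsion_zpow_le_geomPrimaryTorsion W p m)) fun _ _ ↦ rfl).comp
      (resOfLe (geomTorsion W ((p : ℤ) ^ m)) h₂₃) =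
    resH1Hom (subgroupInclusion (h₁₂.trans h₂₃))
        (AddSubgroup.inclusion (geomTorsion_zpow_le_geomPrimaryTorsion W p m)) fun _ _ ↦ rfl := by
  rw [resOfLe, resH1Hom_comp]
  exact resH1Hom_congr (ContinuousMonoidHom.ext fun _ ↦ rfl) (AddMonoidHom.ext fun _ ↦ rfl) _ _

omit [Fact p.Prime] in
/-- Generic worker for `toInfty_comp_conjH1`: for normal subgroups `H₁ ≤ H₂` of `Γ_K` and `σ ∈ Γ_K`,
the map `H¹(H₂, E[p^m]) → H¹(H₁, E[p^∞])` induced by `(H₁ ↪ H₂, E[p^m] ↪ E[p^∞])` intertwines the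
conjugations `conj_σ` (both composites are induced by the same compatible pair).
[cite: NeukirchSchmidtWingberg2008, I.§5] -/
theorem resH1Hom_inclusion_comp_conjH1 {H₁ H₂ : Subgroup (absoluteGaloisGroup K)} [H₁.Normal]
    [H₂.Normal] (h₁₂ : H₁ ≤ H₂) (m : ℕ) (σ : absoluteGaloisGroup K) :
    (resH1Hom (N := W.geomPrimaryTorsion p) (subgroupInclusion h₁₂)
        (AddSubgroup.inclusion (geomTorsion_zpow_le_geomPrimaryTorsion W p m)) fun _ _ ↦ rfl).comp
      (conjH1 H₂ (geomTorsion W ((p : ℤ) ^ m)) σ) =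
    (conjH1 H₁ (W.geomPrimaryTorsion p) σ).comp
      (resH1Hom (N := W.geomPrimaryTorsion p) (subgroupInclusion h₁₂)
        (AddSubgroup.inclusion (geomTorsion_zpow_le_geomPrimaryTorsion W p m)) fun _ _ ↦ rfl) := by
  rw [conjH1, conjH1, resH1Hom_comp, resH1Hom_comp]
  exact resH1Hom_congr (ContinuousMonoidHom.ext fun _ ↦ rfl) (AddMonoidHom.ext fun _ ↦ rfl) _ _

/-- **`θ_{n,m} : H¹(K_n, E[p^m]) → H¹(K_∞, E[p^∞])`**: restriction along `Gal(K̄/K_∞) ≤ Gal(K̄/K_n)`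
followed by the coefficient map `E[p^m] ↪ E[p^∞]` (one `resH1Hom` for the compatible pair). This is
the map "`H¹(K_n, A_m) → H¹(K_{n}, A)[p^m] → H¹(K_{∞}, A)`" through which Hatley–Lei–Vigni identify
their finite-level conditions `ℋ^±_{n,v}[p^m]` inside `H¹(K_{∞,v}, A)` (Remark 3.1: "we may identify
`ℋ^±_{n,v}` and `ℋ^±_{n,v}[p^m]` as submodules of `H¹(K_{n,v}, A)` and `H¹(K_{n,v}, A_m)`").
[cite: HatleyLeiVigni2022, Remark 3.1 and (3.1)] -/
def toInfty (n m : ℕ) :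
    W.torsionH1Over ((p : ℤ) ^ m) (κ.layerSubgroup n) →+ W.subgroupH1 p κ.kerSubgroup :=
  resH1Hom (subgroupInclusion (κ.kerSubgroup_le_layerSubgroup n))
    (AddSubgroup.inclusion (geomTorsion_zpow_le_geomPrimaryTorsion W p m)) fun _ _ ↦ rfl

/-- `θ_{n,m} ∘ conj_σ = conj_σ ∘ θ_{n,m}` for `σ ∈ Γ_K`. [cite: NeukirchSchmidtWingberg2008, I.§5] -/
theorem toInfty_comp_conjH1 (n m : ℕ) (σ : absoluteGaloisGroup K) :
    (toInfty W p κ n m).comp (conjH1 (κ.layerSubgroup n) (geomTorsion W ((p : ℤ) ^ m)) σ) =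
      (conjH1 κ.kerSubgroup (W.geomPrimaryTorsion p) σ).comp (toInfty W p κ n m) :=
  resH1Hom_inclusion_comp_conjH1 W p (κ.kerSubgroup_le_layerSubgroup n) m σ

/-- `θ_{n,m}` commutes with the conjugation action of `Γ_K` (applied form).
[cite: NeukirchSchmidtWingberg2008, I.§5] -/
theorem toInfty_conjH1 (n m : ℕ) (σ : absoluteGaloisGroup K)
    (y : W.torsionH1Over ((p : ℤ) ^ m) (κ.layerSubgroup n)) :
    toInfty W p κ n m (conjH1 (κ.layerSubgroup n) (geomTorsion W ((p : ℤ) ^ m)) σ y) =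
      conjH1 κ.kerSubgroup (W.geomPrimaryTorsion p) σ (toInfty W p κ n m y) := by
  rw [← AddMonoidHom.comp_apply, toInfty_comp_conjH1, AddMonoidHom.comp_apply]

/-- `θ_{n',m} ∘ res_{K_n → K_{n'}} = θ_{n,m}` for `n ≤ n'` (transitivity of restriction).
[cite: NeukirchSchmidtWingberg2008, I.§5] -/
theorem toInfty_comp_resOfLe {n n' : ℕ} (h : n ≤ n') (m : ℕ) :
    (toInfty W p κ n' m).comp (resOfLe (geomTorsion W ((p : ℤ) ^ m))
      (κ.layerSubgroup_antitone h)) = toInfty W p κ n m :=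
  resH1Hom_inclusion_comp_resOfLe W p (κ.kerSubgroup_le_layerSubgroup n')
    (κ.layerSubgroup_antitone h) m

/-- `θ_{n',m} (res_{K_n → K_{n'}} y) = θ_{n,m} y` for `n ≤ n'` (applied form).
[cite: NeukirchSchmidtWingberg2008, I.§5] -/
theorem toInfty_resOfLe {n n' : ℕ} (h : n ≤ n') (m : ℕ)
    (y : W.torsionH1Over ((p : ℤ) ^ m) (κ.layerSubgroup n)) :
    toInfty W p κ n' m (resOfLe (geomTorsion W ((p : ℤ) ^ m)) (κ.layerSubgroup_antitone h) y) =
      toInfty W p κ n m y := by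
  rw [← AddMonoidHom.comp_apply, toInfty_comp_resOfLe W p κ h]

end ToInfty

/-! ## Part 2. The finite-level conditions with torsion coefficients and the nine groups
`Sel^{𝓛}_{p^m}(E/K_n) ⊆ H¹(K_n, E[p^m])` -/

section Conditions

variable {K : Type u} [Field K] [NumberField K] (W : WeierstrassCurve K) (p : ℕ) [Fact p.Prime]
  (κ : ZpExtension K p)

/-- **The condition of type `L ∈ {rel, ±, str}` above `v ∣ p` at level `(n, m)`**: the pullback of
the `K_∞`-level condition `AcSigned.condAbove W p κ v L ≤ H¹(K_∞, E[p^∞])` along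
`θ_{n,m} : H¹(K_n, E[p^m]) → H¹(K_∞, E[p^∞])`. For `L = sgn ε` this is Hatley–Lei–Vigni's
`ℋ^ε_{n,v}[p^m]`-condition at every place of `K_n` above `v`: (3.1) "`ℋ^±_v := ⋃_n Ê^±(K_{n,v}) ⊗
ℚ_p/ℤ_p`", "`ℋ^±_{n,v} := (ℋ^±_v)^{Gal(K_{∞,v}/K_{n,v})}`", Remark 3.1 (identification of
`ℋ^±_{n,v}[p^m]` inside `H¹(K_{n,v}, A_m)` through `H¹(K_{n,v}, A_m) = H¹(K_{∞,v}, A)^{𝒢}[p^m]`) and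
Def. 3.4 (the local condition `H¹(K_{n,v}, A_m)/ℋ^±_{n,v}[p^m]` at `v ∣ p`) = B.-D. Kim 2013 Def. 3.5;
by Prop. 3.2 (b) it is its own exact annihilator under the local Tate pairing, so it is ALSO the
finite-level condition of the compact side (Castella–Wan Def. 3.6 / Def. 4.6 / §6.1:
`H¹_±(K_v, 𝐓^ac_{v₁}) ≃ lim←_m H¹_±(K^ac_{m,v₁}, T)`; flag `HLV-vs-Kob-layers`). For `L = str` it
reads "the image in `H¹(K_{∞,w}, E[p^∞])` vanishes", for `L = rel` it is no condition.
[cite: HatleyLeiVigni2022, (3.1), Remark 3.1, Def. 3.4] [cite: BDKim2013, Def. 3.5 (p. 194)]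
[cite: CastellaWan2023, Def. 5.1 (journal p. 2617 = MS p. 23)] -/
def condAboveTorsion (v : HeightOneSpectrum (𝓞 K)) (L : PCond) (n m : ℕ) :
    AddSubgroup (W.torsionH1Over ((p : ℤ) ^ m) (κ.layerSubgroup n)) :=
  (condAbove W p κ v L).comap (toInfty W p κ n m)

/-- Membership in `condAboveTorsion` (unfolding). [cite: HatleyLeiVigni2022, Def. 3.4] -/
theorem mem_condAboveTorsion_iff (v : HeightOneSpectrum (𝓞 K)) (L : PCond) (n m : ℕ)
    (c : W.torsionH1Over ((p : ℤ) ^ m) (κ.layerSubgroup n)) :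
    c ∈ condAboveTorsion W p κ v L n m ↔ toInfty W p κ n m c ∈ condAbove W p κ v L :=
  Iff.rfl

/-- The relaxed condition is no condition. [cite: CastellaWan2023, Def. 5.1 (MS p. 23)] -/
@[simp] theorem condAboveTorsion_rel (v : HeightOneSpectrum (𝓞 K)) (n m : ℕ) :
    condAboveTorsion W p κ v .rel n m = ⊤ := by
  ext c; simp [mem_condAboveTorsion_iff, condAbove]

/-- Each `condAboveTorsion` is stable under the conjugation action of `Γ_K` (it is imposed at
every place of `K_n` above `v`; `θ_{n,m}` is `Γ_K`-equivariant). [cite: HatleyLeiVigni2022, Def. 3.4] -/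
theorem conjH1_mem_condAboveTorsion (v : HeightOneSpectrum (𝓞 K)) (L : PCond) (n m : ℕ)
    (σ : absoluteGaloisGroup K) {c : W.torsionH1Over ((p : ℤ) ^ m) (κ.layerSubgroup n)}
    (hc : c ∈ condAboveTorsion W p κ v L n m) :
    conjH1 (κ.layerSubgroup n) (geomTorsion W ((p : ℤ) ^ m)) σ c ∈ condAboveTorsion W p κ v L n m := by
  rw [mem_condAboveTorsion_iff, toInfty_conjH1]
  exact conjH1_mem_condAbove W p κ v L σ hc

/-- Restriction `K_n → K_{n'}` (`n ≤ n'`) preserves each condition above `p` (the conditions are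
pulled back from `K_∞`). This is the map of Hatley–Lei–Vigni's Lemma 3.8.
[cite: HatleyLeiVigni2022, Lemma 3.8] -/
theorem resOfLe_mem_condAboveTorsion (v : HeightOneSpectrum (𝓞 K)) (L : PCond) {n n' : ℕ}
    (h : n ≤ n') (m : ℕ) {c : W.torsionH1Over ((p : ℤ) ^ m) (κ.layerSubgroup n)}
    (hc : c ∈ condAboveTorsion W p κ v L n m) :
    resOfLe (geomTorsion W ((p : ℤ) ^ m)) (κ.layerSubgroup_antitone h) c ∈
      condAboveTorsion W p κ v L n' m := by
  rw [mem_condAboveTorsion_iff, toInfty_resOfLe W p κ h]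
  exact hc

variable (H : Subgroup (absoluteGaloisGroup K)) [H.Normal]

/-- **The classical local conditions AWAY from `p`** on `H¹(H, E[m])` (`H = Gal(K̄/L)` normal in
`Γ_K`): the class dies in `H¹(L_w, E)` at every place `w` of `L` above a finite `v ∤ p` and above
every infinite place — verbatim the corresponding components of the tree's classical
`WeierstrassCurve.selmerTorsionOver` (Perrin-Riou 1987 §0), i.e. Hatley–Lei–Vigni's
"`H¹(K_{n,v}, A_m)/(E(K_{n,v})/p^m)` for `v ∤ p`" of Def. 3.4 (flag `away-p-compact`: Castella–Wan's
compact `𝓕_±` is `H¹(K_v, 𝐓^ac)`, no condition, at `v ∤ p`, §4.2).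
[cite: HatleyLeiVigni2022, Def. 3.3–3.4] [cite: PerrinRiou1987BSMF, §0 p. 401] -/
def awayTorsionOver (m : ℤ) : AddSubgroup (W.torsionH1Over m H) :=
  (⨅ (v : HeightOneSpectrum (𝓞 K)) (_ : ((p : ℕ) : 𝓞 K) ∉ v.asIdeal) (σ : absoluteGaloisGroup K),
      (W.localResTorsionOverOfEmb m H (closureEmb (K := K) (v.adicCompletion K))).ker.comap
        (conjH1 H (geomTorsion W m) σ)) ⊓
    ⨅ (w : InfinitePlace K) (σ : absoluteGaloisGroup K),
      (W.localResTorsionOverOfEmb m H (closureEmb (K := K) w.Completion)).ker.comap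
        (conjH1 H (geomTorsion W m) σ)

omit [Fact p.Prime] in
/-- Membership in `awayTorsionOver`. [cite: HatleyLeiVigni2022, Def. 3.3–3.4] -/
theorem mem_awayTorsionOver_iff (m : ℤ) (c : W.torsionH1Over m H) :
    c ∈ awayTorsionOver W p H m ↔
      (∀ v : HeightOneSpectrum (𝓞 K), ((p : ℕ) : 𝓞 K) ∉ v.asIdeal → ∀ σ : absoluteGaloisGroup K,
        W.localResTorsionOverOfEmb m H (closureEmb (K := K) (v.adicCompletion K))
          (conjH1 H (geomTorsion W m) σ c) = 0) ∧
      ∀ (w : InfinitePlace K) (σ : absoluteGaloisGroup K),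
        W.localResTorsionOverOfEmb m H (closureEmb (K := K) w.Completion)
          (conjH1 H (geomTorsion W m) σ c) = 0 := by
  simp only [awayTorsionOver, AddSubgroup.mem_inf, AddSubgroup.mem_iInf, AddSubgroup.mem_comap,
    AddMonoidHom.mem_ker]

omit [Fact p.Prime] in
/-- The classical `m`-Selmer group satisfies the away-from-`p` conditions (they are a subset of
its defining conditions). [cite: PerrinRiou1987BSMF, §0 p. 401] -/
theorem selmerTorsionOver_le_awayTorsionOver (m : ℤ) :
    W.selmerTorsionOver H m ≤ awayTorsionOver W p H m := by
  intro c hc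
  simp only [WeierstrassCurve.selmerTorsionOver, AddSubgroup.mem_inf, AddSubgroup.mem_iInf,
    AddSubgroup.mem_comap, AddMonoidHom.mem_ker] at hc
  rw [mem_awayTorsionOver_iff]
  exact ⟨fun v _ σ ↦ hc.1 v σ, hc.2⟩

omit [Fact p.Prime] in
/-- The away-from-`p` conditions are `Γ_K`-stable (imposed at all conjugates; `conj_τ conj_σ =
conj_{τσ}`). [cite: PerrinRiou1987BSMF, §0 p. 401] -/
theorem conjH1_mem_awayTorsionOver (m : ℤ) (σ : absoluteGaloisGroup K) {c : W.torsionH1Over m H}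
    (hc : c ∈ awayTorsionOver W p H m) :
    conjH1 H (geomTorsion W m) σ c ∈ awayTorsionOver W p H m := by
  rw [mem_awayTorsionOver_iff] at hc ⊢
  have hmul : ∀ τ, conjH1 H (geomTorsion W m) τ (conjH1 H (geomTorsion W m) σ c) =
      conjH1 H (geomTorsion W m) (τ * σ) c := fun τ ↦ by
    rw [conjH1_mul_holds H (geomTorsion W m) τ σ]; rfl
  exact ⟨fun v hv τ ↦ by rw [hmul]; exact hc.1 v hv (τ * σ), fun w τ ↦ by rw [hmul]; exact hc.2 w (τ * σ)⟩

/-- **`Sel^{𝓛}_{p^m}(E/K_n) ⊆ H¹(K_n, E[p^m])`** for an assignment `𝓛` of condition types to the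
primes above `p`: the classical conditions away from `p` (`awayTorsionOver`) and
`condAboveTorsion v (𝓛 v)` at every `v ∣ p`. For `𝓛 ≡ sgn ε` this is Hatley–Lei–Vigni's
`Sel^±_{p^m}(E/K_n)` (Def. 3.4) = B.-D. Kim's finite-level signed Selmer group (Def. 3.5), the
common finite level of the discrete `Sel^±_{p^∞}(E/K_∞) = lim→_{n,m}` and of the compact
`Sel_±(K, 𝐓^ac) = lim←_{n,m}` (Castella–Wan (4.7), Def. 5.1 with `M = 𝐓^ac`; flags
`CW24-local-condition`, `away-p-compact`, `HLV-vs-Kob-layers`). [cite: HatleyLeiVigni2022, Def. 3.4]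
[cite: BDKim2013, Def. 3.5 (p. 194)] [cite: CastellaWan2023, (4.7) and Def. 5.1 (MS pp. 22–23)] -/
def selmerTorsion (L : HeightOneSpectrum (𝓞 K) → PCond) (n m : ℕ) :
    AddSubgroup (W.torsionH1Over ((p : ℤ) ^ m) (κ.layerSubgroup n)) :=
  awayTorsionOver W p (κ.layerSubgroup n) ((p : ℤ) ^ m) ⊓
    ⨅ (v : HeightOneSpectrum (𝓞 K)) (_ : ((p : ℕ) : 𝓞 K) ∈ v.asIdeal),
      condAboveTorsion W p κ v (L v) n m

variable {W p κ}

/-- Membership in `Sel^{𝓛}_{p^m}(E/K_n)`. [cite: HatleyLeiVigni2022, Def. 3.4] -/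
theorem mem_selmerTorsion_iff {L : HeightOneSpectrum (𝓞 K) → PCond} {n m : ℕ}
    (c : W.torsionH1Over ((p : ℤ) ^ m) (κ.layerSubgroup n)) :
    c ∈ selmerTorsion W p κ L n m ↔ c ∈ awayTorsionOver W p (κ.layerSubgroup n) ((p : ℤ) ^ m) ∧
      ∀ v : HeightOneSpectrum (𝓞 K), ((p : ℕ) : 𝓞 K) ∈ v.asIdeal →
        c ∈ condAboveTorsion W p κ v (L v) n m := by
  simp only [selmerTorsion, AddSubgroup.mem_inf, AddSubgroup.mem_iInf]

/-- `Sel^{𝓛}_{p^m}(E/K_n)` is stable under the conjugation action of `Γ_K` (so `ℤ_p[Gal(K_n/K)]`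
acts; Hatley–Lei–Vigni: "an isomorphism of `Λ`-modules"). [cite: HatleyLeiVigni2022, Def. 3.4 and Prop. 3.9] -/
theorem conjH1_mem_selmerTorsion {L : HeightOneSpectrum (𝓞 K) → PCond} {n m : ℕ}
    (σ : absoluteGaloisGroup K) {c : W.torsionH1Over ((p : ℤ) ^ m) (κ.layerSubgroup n)}
    (hc : c ∈ selmerTorsion W p κ L n m) :
    conjH1 (κ.layerSubgroup n) (geomTorsion W ((p : ℤ) ^ m)) σ c ∈ selmerTorsion W p κ L n m := by
  rw [mem_selmerTorsion_iff] at hc ⊢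
  exact ⟨conjH1_mem_awayTorsionOver W p _ _ σ hc.1,
    fun v hv ↦ conjH1_mem_condAboveTorsion W p κ v (L v) n m σ (hc.2 v hv)⟩

/-- Relaxing a condition above `p` enlarges the group: if `𝓛' v = 𝓛 v` or `𝓛' v = rel` at every
`v ∣ p` then `Sel^{𝓛}_{p^m}(E/K_n) ≤ Sel^{𝓛'}_{p^m}(E/K_n)` (e.g. `Sel_± ≤ Sel^{±,rel}`, the inclusion
of Castella–Wan (6.13)). [cite: CastellaWan2023, Def. 5.1 and (6.12)–(6.13) (MS pp. 23, 30)] -/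
theorem selmerTorsion_le_of_rel {L L' : HeightOneSpectrum (𝓞 K) → PCond} {n m : ℕ}
    (h : ∀ v : HeightOneSpectrum (𝓞 K), ((p : ℕ) : 𝓞 K) ∈ v.asIdeal → L' v = L v ∨ L' v = .rel) :
    selmerTorsion W p κ L n m ≤ selmerTorsion W p κ L' n m := by
  intro c hc
  rw [mem_selmerTorsion_iff] at hc ⊢
  refine ⟨hc.1, fun v hv ↦ ?_⟩
  rcases h v hv with h' | h'
  · rw [h']; exact hc.2 v hv
  · rw [h', condAboveTorsion_rel]; exact AddSubgroup.mem_top _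

/-- **The classical `p^m`-Selmer group lies in the `p`-relaxed one**:
`Sel_{p^m}(E/K_n) ≤ Sel^{rel,rel}_{p^m}(E/K_n)` (same conditions away from `p`, none above `p`) —
the finite level of "`Sel(K^ac_∞, T_pE) ⊂ 𝔖𝔢𝔩^{rel,rel}`". [cite: CastellaWan2023, Def. 5.1 (MS p. 23)] -/
theorem selmerTorsionOver_le_selmerTorsion_rel (n m : ℕ) :
    W.selmerTorsionOver (κ.layerSubgroup n) ((p : ℤ) ^ m) ≤ selmerTorsion W p κ (fun _ ↦ .rel) n m := by
  intro c hc
  rw [mem_selmerTorsion_iff]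
  exact ⟨selmerTorsionOver_le_awayTorsionOver W p _ _ hc,
    fun v _ ↦ by rw [condAboveTorsion_rel]; exact AddSubgroup.mem_top _⟩

/-- Restriction `K_n → K_{n'}` carries `Sel^{𝓛}_{p^m}(E/K_n)` into `Sel^{𝓛}_{p^m}(E/K_{n'})` as far as
the conditions ABOVE `p` are concerned (they are pulled back from `K_∞`); together with the
classical compatibility away from `p` this is the map of Hatley–Lei–Vigni Lemma 3.8 / Prop. 3.9.
[cite: HatleyLeiVigni2022, Lemma 3.8] -/
theorem resOfLe_mem_condAboveTorsion_of_mem_selmerTorsion {L : HeightOneSpectrum (𝓞 K) → PCond}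
    {n n' : ℕ} (h : n ≤ n') {m : ℕ} {c : W.torsionH1Over ((p : ℤ) ^ m) (κ.layerSubgroup n)}
    (hc : c ∈ selmerTorsion W p κ L n m) {v : HeightOneSpectrum (𝓞 K)}
    (hv : ((p : ℕ) : 𝓞 K) ∈ v.asIdeal) :
    resOfLe (geomTorsion W ((p : ℤ) ^ m)) (κ.layerSubgroup_antitone h) c ∈
      condAboveTorsion W p κ v (L v) n' m :=
  resOfLe_mem_condAboveTorsion W p κ v (L v) h m ((mem_selmerTorsion_iff c).1 hc |>.2 v hv)

variable (W p κ)

/-- **`Sel^{𝓛}(K_n, T) := lim←_m Sel^{𝓛}_{p^m}(E/K_n)`** as the subgroup of `∏_m H¹(K_n, E[p^m])` of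
the families `(x_m)` with `x_m ∈ Sel^{𝓛}_{p^m}(E/K_n)` and `p_* x_{m+1} = x_m` — verbatim the
shape of the tree's classical `WeierstrassCurve.compactSelmerOver` (Perrin-Riou's `S_p(E/L)`), with
the conditions above `p` replaced by `𝓛`. For `𝓛 ≡ sgn ε` and `n = 0` this is Castella–Wan's
"`Sel_+(K, T)` … identified with the pro-`p` Selmer group `Š_p(E/K) = lim←_m Sel_{p^m}(E/K)`"
(p. 32 of the MS, given Hatley–Lei–Vigni Lemma 3.7); in general the level-`n` term of
`Sel^{𝓛}(K, 𝐓^ac) = lim←_n Sel^{𝓛}(K_n, T)` (Shapiro, (3.10)/(4.7); §6.1 "`lim←_m H¹_±(K^ac_{m,v₁}, T)`").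
[cite: CastellaWan2023, (4.7), Def. 5.1 and §6.3 p. 32 (MS)] [cite: PerrinRiou1987BSMF, §0 p. 401] -/
def compactSelmerLayer (L : HeightOneSpectrum (𝓞 K) → PCond) (n : ℕ) :
    AddSubgroup (Π m : ℕ, W.torsionH1Over ((p : ℤ) ^ m) (κ.layerSubgroup n)) :=
  (AddSubgroup.pi Set.univ fun m ↦ selmerTorsion W p κ L n m) ⊓
    ⨅ m : ℕ, AddMonoidHom.ker
      (((W.reduceTorsionH1 p m (κ.layerSubgroup n)).comp
          (Pi.evalAddMonoidHom (fun j : ℕ ↦ W.torsionH1Over ((p : ℤ) ^ j) (κ.layerSubgroup n))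
            (m + 1))) -
        Pi.evalAddMonoidHom (fun j : ℕ ↦ W.torsionH1Over ((p : ℤ) ^ j) (κ.layerSubgroup n)) m)

variable {W p κ}

/-- Membership in `Sel^{𝓛}(K_n, T)`: Selmer at every level and compatible under `p_*`.
[cite: CastellaWan2023, (4.7) and Def. 5.1 (MS pp. 22–23)] -/
theorem mem_compactSelmerLayer_iff {L : HeightOneSpectrum (𝓞 K) → PCond} {n : ℕ}
    (x : Π m : ℕ, W.torsionH1Over ((p : ℤ) ^ m) (κ.layerSubgroup n)) :
    x ∈ compactSelmerLayer W p κ L n ↔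
      (∀ m, x m ∈ selmerTorsion W p κ L n m) ∧
        ∀ m, W.reduceTorsionH1 p m (κ.layerSubgroup n) (x (m + 1)) = x m := by
  simp only [compactSelmerLayer, AddSubgroup.mem_inf, AddSubgroup.mem_pi, Set.mem_univ,
    true_implies, AddSubgroup.mem_iInf, AddMonoidHom.mem_ker, AddMonoidHom.sub_apply,
    AddMonoidHom.coe_comp, Function.comp_apply, Pi.evalAddMonoidHom_apply, sub_eq_zero]

/-- **`S_p(E/K_n) ≤ Sel^{rel,rel}(K_n, T)`**: the classical compact Selmer group lies in the
`p`-relaxed compact group (Castella–Wan: "`𝔖𝔢𝔩^{±,±}(K^ac_∞, T_pE) ⊃ Sel(K^ac_∞, T_pE)`" is this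
followed by the FACT `E(k) ⊗ ℤ_p ⊂ H¹_±(k, T)`, MS p. 15, which is not a containment of the
finite-level conditions used here — flag `HLV-vs-Kob-layers`).
[cite: CastellaWan2023, §3.3 p. 15 (MS) and Def. 5.1] -/
theorem compactSelmerOver_le_compactSelmerLayer_rel (n : ℕ) :
    W.compactSelmerOver (κ.layerSubgroup n) p ≤ compactSelmerLayer W p κ (fun _ ↦ .rel) n := by
  intro x hx
  rw [WeierstrassCurve.mem_compactSelmerOver_iff] at hx
  rw [mem_compactSelmerLayer_iff]
  exact ⟨fun m ↦ selmerTorsionOver_le_selmerTorsion_rel n m (hx.1 m), hx.2⟩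

end Conditions

/-! ## Part 3. The `Λ^ac`-adic modules `lim←_n` of norm-compatible families (CONSTRUCTED, with the
truncated `ℤ_p⟦T⟧`-action; the module structure is a `def`, no instance) -/

section LambdaAdic

variable {K : Type u} [Field K] (W : WeierstrassCurve K) (p : ℕ) [Fact p.Prime]
  (κ : ZpExtension K p) (γ : absoluteGaloisGroup K)

/-- **The `Λ`-adic families cut out by a family of level conditions `C n m ≤ H¹(K_n, E[p^m])`**:
the subgroup of `∏_n ∏_m H¹(K_n, E[p^m])` of the `x = (x_{n,m})` with `x_{n,m} ∈ C n m`,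
`p_* x_{n,m+1} = x_{n,m}` (so `x_n ∈ lim←_m H¹(K_n, E[p^m]) = H¹(K_n, T)`) and
`res_{K_n → K_{n+1}} x_n = Σ_{i<p} conj_{γ^{pⁿ i}} x_{n+1}` (norm compatibility in the convention of
`WeierstrassCurve.LambdaAdicSelmerData.proj_norm`: `res ∘ cor = N_{K_{n+1}/K_n}`), i.e. the model of
`lim←_n H¹_{C}(K_n, T) ⊂ H¹(K, 𝐓^ac) = lim←_n H¹(K_n, T)` (Shapiro's lemma, Castella–Wan (3.10),
§4.1 "`H¹(K, 𝐓̃) ≃ lim←_n H¹(K[p^n], T)` given by Shapiro's lemma") used by the tree for the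
classical compact Selmer module (`LambdaAdicSelmerDataExists.nonempty_lambdaAdicSelmerData`).
[cite: CastellaWan2023, (3.10) and §4.1 (MS pp. 14, 19)] [cite: PerrinRiou1987BSMF, §0 p. 402] -/
def lambdaAdic (C : ∀ n m : ℕ, AddSubgroup (W.torsionH1Over ((p : ℤ) ^ m) (κ.layerSubgroup n))) :
    AddSubgroup (Π n m : ℕ, W.torsionH1Over ((p : ℤ) ^ m) (κ.layerSubgroup n)) where
  carrier := {x | (∀ n m, x n m ∈ C n m) ∧
    (∀ n m, W.reduceTorsionH1 p m (κ.layerSubgroup n) (x n (m + 1)) = x n m) ∧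
    ∀ n, W.resPi p (κ.layerSubgroup_antitone (Nat.le_succ n)) (x n) =
      ∑ i ∈ Finset.range p, W.conjPi p (κ.layerSubgroup (n + 1)) (γ ^ (p ^ n * i)) (x (n + 1))}
  zero_mem' := ⟨fun n m ↦ zero_mem _, fun n m ↦ by simp, fun n ↦ by simp⟩
  add_mem' := fun {x y} hx hy ↦ ⟨fun n m ↦ add_mem (hx.1 n m) (hy.1 n m),
    fun n m ↦ by rw [Pi.add_apply, Pi.add_apply, map_add, hx.2.1 n m, hy.2.1 n m]; rfl,
    fun n ↦ by
      rw [Pi.add_apply, map_add, hx.2.2 n, hy.2.2 n, ← Finset.sum_add_distrib]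
      exact Finset.sum_congr rfl fun i _ ↦ (map_add _ _ _).symm⟩
  neg_mem' := fun {x} hx ↦ ⟨fun n m ↦ neg_mem (hx.1 n m),
    fun n m ↦ by rw [Pi.neg_apply, Pi.neg_apply, map_neg, hx.2.1 n m]; rfl,
    fun n ↦ by
      rw [Pi.neg_apply, map_neg, hx.2.2 n, ← Finset.sum_neg_distrib]
      exact Finset.sum_congr rfl fun i _ ↦ (map_neg _ _).symm⟩

variable {W p κ γ}

/-- Membership in `lambdaAdic C` (unfolding). [cite: PerrinRiou1987BSMF, §0 p. 402] -/
theorem mem_lambdaAdic_iff {C : ∀ n m : ℕ, AddSubgroup (W.torsionH1Over ((p : ℤ) ^ m) (κ.layerSubgroup n))}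
    (x : Π n m : ℕ, W.torsionH1Over ((p : ℤ) ^ m) (κ.layerSubgroup n)) :
    x ∈ lambdaAdic W p κ γ C ↔ (∀ n m, x n m ∈ C n m) ∧
      (∀ n m, W.reduceTorsionH1 p m (κ.layerSubgroup n) (x n (m + 1)) = x n m) ∧
      ∀ n, W.resPi p (κ.layerSubgroup_antitone (Nat.le_succ n)) (x n) =
        ∑ i ∈ Finset.range p, W.conjPi p (κ.layerSubgroup (n + 1)) (γ ^ (p ^ n * i)) (x (n + 1)) :=
  Iff.rfl

/-- `lambdaAdic` is monotone in the level conditions — the mechanism of the relaxation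
containments `Sel^{str,·} ⊆ Sel^{±,·} ⊆ Sel^{rel,·}(K, 𝐓^ac)` in Castella–Wan's (6.12)–(6.13).
[cite: CastellaWan2023, (6.12)–(6.13) (MS p. 30)] -/
theorem lambdaAdic_mono {C C' : ∀ n m : ℕ, AddSubgroup (W.torsionH1Over ((p : ℤ) ^ m) (κ.layerSubgroup n))}
    (h : ∀ n m, C n m ≤ C' n m) : lambdaAdic W p κ γ C ≤ lambdaAdic W p κ γ C' :=
  fun _ hx ↦ ⟨fun n m ↦ h n m (hx.1 n m), hx.2⟩

variable (W p κ γ)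

/-- `ψ_{n,m} = conj_γ − 1` on `H¹(K_n, E[p^m])` — the operator through which `T ∈ ℤ_p⟦T⟧` acts
(`T = γ − 1`, Castella–Wan §4.1 "`Y = γ^ac − 1`"). [cite: CastellaWan2023, §4.1 (MS p. 19)] -/
def psi (n m : ℕ) : AddMonoid.End (W.torsionH1Over ((p : ℤ) ^ m) (κ.layerSubgroup n)) :=
  conjH1 (κ.layerSubgroup n) (geomTorsion W ((p : ℤ) ^ m)) γ - AddMonoidHom.id _

/-- Unfolding `psi`. [cite: CastellaWan2023, §4.1 (MS p. 19)] -/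
theorem psi_apply (n m : ℕ) (y : W.torsionH1Over ((p : ℤ) ^ m) (κ.layerSubgroup n)) :
    psi W p κ γ n m y = conjH1 (κ.layerSubgroup n) (geomTorsion W ((p : ℤ) ^ m)) γ y - y :=
  rfl

/-- **The truncated `ℤ_p⟦T⟧`-action on families**: on the `(n, m)` component `f` acts by
`Σ_{i < m pⁿ} coeff_i(f) (conj_γ − 1)^i` (`IwasawaDual.evalT`), legitimate because
`(conj_γ − 1)^{m pⁿ} = 0` on `H¹(K_n, E[p^m])` for a topological generator `γ`
(`LambdaAdicSelmerDataExists.psi_pow_apply_eq_zero`). This is the `Λ^ac`-module structure of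
`H¹(K, 𝐓^ac) = lim← H¹(K_n, T)` (`Λ^ac = lim← ℤ_p[Gal(K_n/K)]`).
[cite: CastellaWan2023, §4.1 (MS p. 19)] [cite: Lang1990, Ch. 5 §1 Thm. 1.1] -/
def tsmul (f : IwasawaAlgebra p) (x : Π n m : ℕ, W.torsionH1Over ((p : ℤ) ^ m) (κ.layerSubgroup n)) :
    Π n m : ℕ, W.torsionH1Over ((p : ℤ) ^ m) (κ.layerSubgroup n) :=
  fun n m ↦ evalT p (psi W p κ γ n m) (m * p ^ n) m f (AddMonoidHom.id _) (x n m)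

variable {W p κ γ}

/-- Every power of `ψ = conj_γ − 1` preserves a `conj_γ`-stable subgroup (so the `Λ = ℤ_p⟦γ − 1⟧`-
action preserves `Γ`-stable Selmer conditions; Perrin-Riou §0, "`𝔖_p(L)` … des `Λ`-modules").
[cite: PerrinRiou1987BSMF, §0 pp. 400–402] -/
theorem psi_pow_mem {n m : ℕ} {C : AddSubgroup (W.torsionH1Over ((p : ℤ) ^ m) (κ.layerSubgroup n))}
    (hC : ∀ y ∈ C, conjH1 (κ.layerSubgroup n) (geomTorsion W ((p : ℤ) ^ m)) γ y ∈ C) (i : ℕ)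
    {c : W.torsionH1Over ((p : ℤ) ^ m) (κ.layerSubgroup n)} (hc : c ∈ C) :
    (psi W p κ γ n m ^ i) c ∈ C := by
  induction i generalizing c with
  | zero => exact hc
  | succ i ih =>
    rw [pow_succ, AddMonoid.End.coe_mul, Function.comp_apply, psi_apply]
    exact ih (sub_mem (hC _ hc) hc)

/-- The truncated action preserves a `conj_γ`-stable subgroup (a sum of multiples of the
`ψ^i c`). [cite: Lang1990, Ch. 5 §1] -/
theorem evalT_mem {n m : ℕ} {C : AddSubgroup (W.torsionH1Over ((p : ℤ) ^ m) (κ.layerSubgroup n))}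
    (hC : ∀ y ∈ C, conjH1 (κ.layerSubgroup n) (geomTorsion W ((p : ℤ) ^ m)) γ y ∈ C) (N : ℕ)
    (f : IwasawaAlgebra p) {c : W.torsionH1Over ((p : ℤ) ^ m) (κ.layerSubgroup n)} (hc : c ∈ C) :
    evalT p (psi W p κ γ n m) N m f (AddMonoidHom.id _) c ∈ C := by
  rw [evalT_def]
  refine AddSubgroup.sum_mem _ fun i _ ↦ ?_
  rw [zpT_def, AddMonoidHom.id_apply]
  exact AddSubgroup.nsmul_mem _ (psi_pow_mem hC i hc) _

/-- `p^m` kills `H¹(K_n, E[p^m])`. [cite: SilvermanAEC2009, VIII.§2] -/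
theorem pow_nsmul_level_eq_zero (n m : ℕ) (y : W.torsionH1Over ((p : ℤ) ^ m) (κ.layerSubgroup n)) :
    p ^ m • y = 0 :=
  pow_nsmul_eq_zero W p _ m y

/-- `ψ^{m pⁿ} = 0` on `H¹(K_n, E[p^m])` for a topological generator `γ`.
[cite: GreenbergLNM1716, §1 (p. 60)] -/
theorem psi_pow_level_eq_zero (hγ : κ.IsTopGenerator γ) (n m : ℕ)
    (y : W.torsionH1Over ((p : ℤ) ^ m) (κ.layerSubgroup n)) :
    (psi W p κ γ n m ^ (m * p ^ n)) y = 0 :=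
  psi_pow_apply_eq_zero (psi_apply W p κ γ n m) (pow_mem_layerSubgroup p κ hγ n) y

/-- **The truncated action preserves the `Λ`-adic families** cut out by `conj_γ`-stable level
conditions: the level conditions by `evalT_mem`, the `p_*`-compatibility and the norm
compatibility by transport of `evalT` along `p_*`, `res`, `conj_{γ^j}` (which commute with
`conj_γ − 1`) and the change of truncation `evalT_of_le` — verbatim the argument of
`LambdaAdicSelmerDataExists.nonempty_lambdaAdicSelmerData`.
[cite: PerrinRiou1987BSMF, §0 p. 402] [cite: Lang1990, Ch. 5 §1 Thm. 1.1] -/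
theorem tsmul_mem (hγ : κ.IsTopGenerator γ)
    {C : ∀ n m : ℕ, AddSubgroup (W.torsionH1Over ((p : ℤ) ^ m) (κ.layerSubgroup n))}
    (hC : ∀ n m, ∀ y ∈ C n m, conjH1 (κ.layerSubgroup n) (geomTorsion W ((p : ℤ) ^ m)) γ y ∈ C n m)
    (f : IwasawaAlgebra p) {x : Π n m : ℕ, W.torsionH1Over ((p : ℤ) ^ m) (κ.layerSubgroup n)}
    (hx : x ∈ lambdaAdic W p κ γ C) : tsmul W p κ γ f x ∈ lambdaAdic W p κ γ C := by
  have hψ : ∀ n m y, psi W p κ γ n m y =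
      conjH1 (κ.layerSubgroup n) (geomTorsion W ((p : ℤ) ^ m)) γ y - y := psi_apply W p κ γ
  have htor := pow_nsmul_level_eq_zero (W := W) (p := p) (κ := κ)
  have hnil := psi_pow_level_eq_zero (W := W) hγ
  rw [mem_lambdaAdic_iff] at hx ⊢
  refine ⟨fun n m ↦ evalT_mem (hC n m) _ f (hx.1 n m), fun n m ↦ ?_, fun n ↦ ?_⟩
  · -- `p_*`-compatibility: transport along `p_*`, then shrink the truncation
    change W.reduceTorsionH1 p m (κ.layerSubgroup n)
        (evalT p (psi W p κ γ n (m + 1)) ((m + 1) * p ^ n) (m + 1) f (AddMonoidHom.id _)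
          (x n (m + 1))) =
      evalT p (psi W p κ γ n m) (m * p ^ n) m f (AddMonoidHom.id _) (x n m)
    rw [map_evalT_id _ _ (W.reduceTorsionH1 p m (κ.layerSubgroup n))
      (reduceTorsionH1_psi p (hψ n (m + 1)) (hψ n m)) ((m + 1) * p ^ n) (m + 1) f (x n (m + 1)),
      hx.2.1 n m]
    exact evalT_of_le (Nat.mul_le_mul_right _ (Nat.le_succ m)) (Nat.le_succ m) f _
      (hnil n m (x n m)) (htor n m (x n m))
  · -- norm compatibility
    funext m
    have hres : W.resPi p (κ.layerSubgroup_antitone (Nat.le_succ n)) (tsmul W p κ γ f x n) m =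
        evalT p (psi W p κ γ (n + 1) m) (m * p ^ n) m f (AddMonoidHom.id _)
          (W.resPi p (κ.layerSubgroup_antitone (Nat.le_succ n)) (x n) m) := by
      simp only [tsmul, WeierstrassCurve.resPi, AddMonoidHom.pi_apply, AddMonoidHom.coe_comp,
        Function.comp_apply, Pi.evalAddMonoidHom_apply]
      exact map_evalT_id _ _ _
        (resOfLe_psi p (κ.layerSubgroup_antitone (Nat.le_succ n)) (hψ n m) (hψ (n + 1) m)) _ _ f _
    have hconj : ∀ i, W.conjPi p (κ.layerSubgroup (n + 1)) (γ ^ (p ^ n * i))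
        (tsmul W p κ γ f x (n + 1)) m =
        evalT p (psi W p κ γ (n + 1) m) (m * p ^ (n + 1)) m f (AddMonoidHom.id _)
          (W.conjPi p (κ.layerSubgroup (n + 1)) (γ ^ (p ^ n * i)) (x (n + 1)) m) := fun i ↦ by
      simp only [tsmul, WeierstrassCurve.conjPi, AddMonoidHom.pi_apply, AddMonoidHom.coe_comp,
        Function.comp_apply, Pi.evalAddMonoidHom_apply]
      exact map_evalT_id _ _ _
        (conjH1_psi_of_commute p (Commute.pow_left (Commute.refl γ) _) (hψ (n + 1) m)) _ _ f _
    -- the restricted class comes from level `n`: it is killed by `ψ^{m pⁿ}` already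
    have hresN : (psi W p κ γ (n + 1) m ^ (m * p ^ n))
        (W.resPi p (κ.layerSubgroup_antitone (Nat.le_succ n)) (x n) m) = 0 := by
      have h := map_pow_apply (psi W p κ γ n m) (psi W p κ γ (n + 1) m)
        (resOfLe (geomTorsion W ((p : ℤ) ^ m)) (κ.layerSubgroup_antitone (Nat.le_succ n)))
        (resOfLe_psi p (κ.layerSubgroup_antitone (Nat.le_succ n)) (hψ n m) (hψ (n + 1) m))
        (m * p ^ n) (x n m)
      simp only [WeierstrassCurve.resPi, AddMonoidHom.pi_apply, AddMonoidHom.coe_comp,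
        Function.comp_apply, Pi.evalAddMonoidHom_apply]
      rw [← h, hnil n m (x n m), map_zero]
    rw [hres, Finset.sum_apply, Finset.sum_congr rfl fun i _ ↦ hconj i,
      ← evalT_of_le (Nat.mul_le_mul_left m (Nat.pow_le_pow_right (Fact.out : p.Prime).pos
        (Nat.le_succ n))) le_rfl f _ hresN (htor (n + 1) m _), congrFun (hx.2.2 n) m,
      Finset.sum_apply]
    exact evalT_id_sum _ _ _ f _ _

/-- **The `Λ^ac = ℤ_p⟦T⟧`-module structure of `lambdaAdic C`** attached to a topological generator
`γ` of `Gal(K_∞/K)` and `conj_γ`-stable level conditions: the truncated action `tsmul`, with the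
module axioms from the `evalT` algebra (`Module.ofMinimalAxioms`) — CONSTRUCTED (the same model as
`LambdaAdicSelmerDataExists.nonempty_lambdaAdicSelmerData` for the classical conditions). A `def`
to be activated with `letI`, NOT an instance (it depends on `hγ`, `hC`); Castella–Wan §4.1:
"we identify `Λ^ac` with the one variable power series ring `ℤ_p⟦Y⟧` setting `Y = γ^ac − 1`".
[cite: CastellaWan2023, §4.1 (MS p. 19)] [cite: Lang1990, Ch. 5 §1 Thm. 1.1] -/
@[reducible]
def lambdaAdic.moduleOfGen (hγ : κ.IsTopGenerator γ)
    {C : ∀ n m : ℕ, AddSubgroup (W.torsionH1Over ((p : ℤ) ^ m) (κ.layerSubgroup n))}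
    (hC : ∀ n m, ∀ y ∈ C n m, conjH1 (κ.layerSubgroup n) (geomTorsion W ((p : ℤ) ^ m)) γ y ∈ C n m) :
    Module (IwasawaAlgebra p) (lambdaAdic W p κ γ C) :=
  letI : SMul (IwasawaAlgebra p) (lambdaAdic W p κ γ C) :=
    ⟨fun f x ↦ ⟨tsmul W p κ γ f x.1, tsmul_mem hγ hC f x.2⟩⟩
  have hsmul : ∀ (f : IwasawaAlgebra p) (x : lambdaAdic W p κ γ C) (n m : ℕ), (f • x).1 n m =
      evalT p (psi W p κ γ n m) (m * p ^ n) m f (AddMonoidHom.id _) (x.1 n m) :=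
    fun _ _ _ _ ↦ rfl
  Module.ofMinimalAxioms
    (fun f x y ↦ Subtype.ext <| funext fun n ↦ funext fun m ↦ by
      rw [hsmul]
      change _ = (f • x).1 n m + (f • y).1 n m
      rw [hsmul, hsmul]
      exact evalT_add_right _ _ f _ _ _)
    (fun f g x ↦ Subtype.ext <| funext fun n ↦ funext fun m ↦ by
      rw [hsmul]
      change _ = (f • x).1 n m + (g • x).1 n m
      rw [hsmul, hsmul]
      exact evalT_add_left f g _ (pow_nsmul_level_eq_zero n m _))
    (fun f g x ↦ Subtype.ext <| funext fun n ↦ funext fun m ↦ by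
      rw [hsmul, hsmul, hsmul]
      exact evalT_id_mul _ f g (psi_pow_level_eq_zero hγ n m _) (pow_nsmul_level_eq_zero n m _))
    (fun x ↦ Subtype.ext <| funext fun n ↦ funext fun m ↦ by
      rw [hsmul]
      exact evalT_one _ (psi_pow_level_eq_zero hγ n m _) (pow_nsmul_level_eq_zero n m _))

/-- Unfolding the action: `(f • x)_{n,m} = Σ_{i < m pⁿ} coeff_i(f) (conj_γ − 1)^i x_{n,m}`
(definitional). [cite: Lang1990, Ch. 5 §1 Thm. 1.1] -/
theorem lambdaAdic.smul_apply (hγ : κ.IsTopGenerator γ)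
    {C : ∀ n m : ℕ, AddSubgroup (W.torsionH1Over ((p : ℤ) ^ m) (κ.layerSubgroup n))}
    (hC : ∀ n m, ∀ y ∈ C n m, conjH1 (κ.layerSubgroup n) (geomTorsion W ((p : ℤ) ^ m)) γ y ∈ C n m)
    (f : IwasawaAlgebra p) (x : lambdaAdic W p κ γ C) (n m : ℕ) :
    (letI := lambdaAdic.moduleOfGen hγ hC; (f • x).1 n m) =
      evalT p (psi W p κ γ n m) (m * p ^ n) m f (AddMonoidHom.id _) (x.1 n m) :=
  rfl

/-- **`T` acts as `conj_γ − 1`** on every component. [cite: CastellaWan2023, §4.1 (MS p. 19, "`Y = γ^ac − 1`")] -/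
theorem lambdaAdic.X_smul_apply (hγ : κ.IsTopGenerator γ)
    {C : ∀ n m : ℕ, AddSubgroup (W.torsionH1Over ((p : ℤ) ^ m) (κ.layerSubgroup n))}
    (hC : ∀ n m, ∀ y ∈ C n m, conjH1 (κ.layerSubgroup n) (geomTorsion W ((p : ℤ) ^ m)) γ y ∈ C n m)
    (x : lambdaAdic W p κ γ C) (n m : ℕ) :
    (letI := lambdaAdic.moduleOfGen hγ hC; ((PowerSeries.X : IwasawaAlgebra p) • x).1 n m) =
      conjH1 (κ.layerSubgroup n) (geomTorsion W ((p : ℤ) ^ m)) γ (x.1 n m) - x.1 n m := by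
  rw [lambdaAdic.smul_apply, evalT_X _ (psi_pow_level_eq_zero hγ n m _) (pow_nsmul_level_eq_zero n m _),
    AddMonoidHom.id_apply, psi_apply]

/-- **Constants `c ∈ ℤ_p` act through `ℤ_p → ℤ/p^m`** on the `(n, m)` component (which is killed
by `p^m`). [cite: Lang1990, Ch. 5 §1] -/
theorem lambdaAdic.C_smul_apply (hγ : κ.IsTopGenerator γ)
    {C : ∀ n m : ℕ, AddSubgroup (W.torsionH1Over ((p : ℤ) ^ m) (κ.layerSubgroup n))}
    (hC : ∀ n m, ∀ y ∈ C n m, conjH1 (κ.layerSubgroup n) (geomTorsion W ((p : ℤ) ^ m)) γ y ∈ C n m)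
    (c : ℤ_[p]) (x : lambdaAdic W p κ γ C) (n m : ℕ) :
    (letI := lambdaAdic.moduleOfGen hγ hC; ((PowerSeries.C c : IwasawaAlgebra p) • x).1 n m) =
      (PadicInt.toZModPow m c).val • x.1 n m := by
  rw [lambdaAdic.smul_apply, evalT_C c _ (psi_pow_level_eq_zero hγ n m _) (pow_nsmul_level_eq_zero n m _),
    AddMonoidHom.id_apply, zpT_def]

end LambdaAdic

/-! ### The compact signed Selmer modules `Sel^{𝓛}(K, 𝐓^ac)` -/

section SelmerLambdaAdic

variable {K : Type u} [Field K] [NumberField K] (W : WeierstrassCurve K) (p : ℕ) [Fact p.Prime]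
  (κ : ZpExtension K p) (γ : absoluteGaloisGroup K)

/-- **`Sel^{𝓛}(K, 𝐓^ac) := lim←_n Sel^{𝓛}(K_n, T)`**, Castella–Wan's compact Selmer group of Def. 5.1
for `M = 𝐓^ac` (for `𝓛 ≡ sgn ε`: `Sel_±(K, 𝐓^ac)` of (4.7), the module containing the signed Heegner
classes `z^±_∞` and whose quotient `Sel_±(K, 𝐓^ac)/Λ^ac z^±_∞` enters Conj. 4.8 / Thm. 6.8 / Thm. A.5):
the `Λ`-adic families (`lambdaAdic`) cut out by the level conditions `Sel^{𝓛}_{p^m}(E/K_n)`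
(`selmerTorsion`). An additive subgroup of `∏_n ∏_m H¹(K_n, E[p^m])`; its `Λ^ac`-module structure is
`selmerLambdaAdic.moduleOfGen` (a `def`). Readings: Shapiro's lemma and
`H¹(K_n, T) = lim←_m H¹(K_n, E[p^m])` (flags `Shapiro`, `lim-m`), the finite-level conditions as in
`selmerTorsion`. [cite: CastellaWan2023, (4.7) and Def. 5.1 (MS pp. 22–23)] -/
def selmerLambdaAdic (L : HeightOneSpectrum (𝓞 K) → PCond) :
    AddSubgroup (Π n m : ℕ, W.torsionH1Over ((p : ℤ) ^ m) (κ.layerSubgroup n)) :=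
  lambdaAdic W p κ γ fun n m ↦ selmerTorsion W p κ L n m

/-- **The `Λ^ac`-module structure of `Sel^{𝓛}(K, 𝐓^ac)`** for a topological generator `γ`
(`lambdaAdic.moduleOfGen` for the `Γ_K`-stable conditions `selmerTorsion`); activate with
`letI := selmerLambdaAdic.moduleOfGen W p κ γ hγ L`. CONSTRUCTED; no instance.
[cite: CastellaWan2023, §4.1–4.2 (MS pp. 19–22)] -/
@[reducible]
def selmerLambdaAdic.moduleOfGen (hγ : κ.IsTopGenerator γ) (L : HeightOneSpectrum (𝓞 K) → PCond) :
    Module (IwasawaAlgebra p) (selmerLambdaAdic W p κ γ L) :=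
  lambdaAdic.moduleOfGen hγ fun _ _ _ hy ↦ conjH1_mem_selmerTorsion γ hy

/-- **"`Sel^{𝓛}(K, 𝐓^ac)` is finitely generated of `Λ^ac`-rank `r`"** (`Module.Finite ∧ finrank = r`
under `moduleOfGen hγ`) — the shape of Castella–Wan Conj. 4.8 (2) / Thm. 6.8 / Thm. A.5
("`Sel_±(K, 𝐓^ac)` has `Λ^ac`-rank one") and Lemma 6.7 (1). A predicate; nothing asserted.
[cite: CastellaWan2023, Conj. 4.8 (2), Lemma 6.7 (1), Thm. A.5 (MS pp. 22, 28, 35)] -/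
def selmerLambdaAdic.HasRank (hγ : κ.IsTopGenerator γ) (L : HeightOneSpectrum (𝓞 K) → PCond)
    (r : ℕ) : Prop :=
  letI := selmerLambdaAdic.moduleOfGen W p κ γ hγ L
  Module.Finite (IwasawaAlgebra p) (selmerLambdaAdic W p κ γ L) ∧
    Module.finrank (IwasawaAlgebra p) (selmerLambdaAdic W p κ γ L) = r

/-- **"`Sel^{𝓛}(K, 𝐓^ac)` is `Λ^ac`-torsion"** (`Module.IsTorsion` under `moduleOfGen hγ`) — the shape
of "`Sel^{str,rel}(K, 𝐓^ac)` … [is] `Λ^ac`-torsion" (Thm. 6.8 (ii)) and "`Sel^{str,±}(K, 𝐓^ac) = 0`,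
since it is of `Λ^ac`-rank zero" (proof of Thm. 6.8). A predicate; nothing asserted.
[cite: CastellaWan2023, Thm. 6.8 (MS p. 30)] -/
def selmerLambdaAdic.IsTorsion (hγ : κ.IsTopGenerator γ) (L : HeightOneSpectrum (𝓞 K) → PCond) :
    Prop :=
  letI := selmerLambdaAdic.moduleOfGen W p κ γ hγ L
  Module.IsTorsion (IwasawaAlgebra p) (selmerLambdaAdic W p κ γ L)

variable {W p κ γ}

/-- Membership in `Sel^{𝓛}(K, 𝐓^ac)`: levelwise in `Sel^{𝓛}(K_n, T)` (`compactSelmerLayer`) and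
norm-compatible. [cite: CastellaWan2023, (4.7) and Def. 5.1 (MS pp. 22–23)] -/
theorem mem_selmerLambdaAdic_iff {L : HeightOneSpectrum (𝓞 K) → PCond}
    (x : Π n m : ℕ, W.torsionH1Over ((p : ℤ) ^ m) (κ.layerSubgroup n)) :
    x ∈ selmerLambdaAdic W p κ γ L ↔ (∀ n, x n ∈ compactSelmerLayer W p κ L n) ∧
      ∀ n, W.resPi p (κ.layerSubgroup_antitone (Nat.le_succ n)) (x n) =
        ∑ i ∈ Finset.range p, W.conjPi p (κ.layerSubgroup (n + 1)) (γ ^ (p ^ n * i)) (x (n + 1)) := by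
  rw [selmerLambdaAdic, mem_lambdaAdic_iff]
  simp only [mem_compactSelmerLayer_iff]
  exact ⟨fun h ↦ ⟨fun n ↦ ⟨fun m ↦ h.1 n m, fun m ↦ h.2.1 n m⟩, h.2.2⟩,
    fun h ↦ ⟨fun n m ↦ (h.1 n).1 m, fun n m ↦ (h.1 n).2 m, h.2⟩⟩

/-- Relaxing conditions above `p` enlarges `Sel^{𝓛}(K, 𝐓^ac)` (`selmerTorsion_le_of_rel` levelwise):
the inclusions `Sel^{str,rel} ⊂ Sel^{±,rel}`-type maps of Castella–Wan (6.12)–(6.13) for the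
relaxations, e.g. `Sel_±(K, 𝐓^ac) ≤ Sel^{±,rel}(K, 𝐓^ac)`.
[cite: CastellaWan2023, (6.12)–(6.13) (MS p. 30)] -/
theorem selmerLambdaAdic_le_of_rel {L L' : HeightOneSpectrum (𝓞 K) → PCond}
    (h : ∀ v : HeightOneSpectrum (𝓞 K), ((p : ℕ) : 𝓞 K) ∈ v.asIdeal → L' v = L v ∨ L' v = .rel) :
    selmerLambdaAdic W p κ γ L ≤ selmerLambdaAdic W p κ γ L' :=
  lambdaAdic_mono fun _ _ ↦ selmerTorsion_le_of_rel h

/-- **Bridge to the classical `Λ`-adic Selmer datum**: for every `D : LambdaAdicSelmerData W κ γ`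
(the tree's `𝔖_p(K_∞) = lim←_n S_p(E/K_n)`, home of the Heegner module of `Howard2004_thmB`) and
`s ∈ D.S`, the family of projections `(D.proj n s)_n` lies in `Sel^{rel,rel}(K, 𝐓^ac)`
(`compactSelmerOver_le_compactSelmerLayer_rel` + `D.proj_norm`). [cite: CastellaWan2023, Def. 5.1 (MS p. 23)]
[cite: Howard2004HeegnerKolyvagin, §1 and Def. 3.2.3] -/
theorem proj_mem_selmerLambdaAdic_rel (D : W.LambdaAdicSelmerData κ γ) (s : D.S) :
    (fun n ↦ D.proj n s) ∈ selmerLambdaAdic W p κ γ (fun _ ↦ .rel) := by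
  rw [mem_selmerLambdaAdic_iff]
  exact ⟨fun n ↦ compactSelmerOver_le_compactSelmerLayer_rel n (D.proj_mem n s), fun n ↦ D.proj_norm n s⟩

end SelmerLambdaAdic

/-! ## Part 4. Hatley–Lei–Vigni's Lemma 3.7 and Prop. 3.9 at finite layers (named facts;
statements only, hypotheses as printed, specialised as documented) -/

section Facts

variable (W : WeierstrassCurve ℚ) [W.IsGloballyMinimal] (K : Type) [Field K] [NumberField K]
  (p : ℕ) [Fact p.Prime] (κ : ZpExtension K p) (𝔭 𝔭' : HeightOneSpectrum (𝓞 K))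

/-- **Hatley–Lei–Vigni 2022, Lemma 3.7: `Sel^±_{p^m}(E/K) = Sel_{p^m}(E/K)` for all `m`** (at the
base `K_0 = K` the signed conditions are the classical ones; proof: "`ℋ^±_{0,v}[p^m]`,
`E(K_v)/p^m E(K_v)` and `H¹(K_v, A_m)/(E(K_v)/p^m E(K_v))` are all free of rank one over `ℤ/p^m ℤ`
… `E(K_v)/p^m E(K_v)` is contained in `ℋ^±_{0,v}[p^m]`"). Standing hypotheses (§1.1–1.2): `p` odd,
`E/ℚ` of conductor `N` with good supersingular reduction at `p` and `a_p(E) = 0`, `K` imaginary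
quadratic with (Heeg) "all the primes dividing `pN` split in `K`", the primes above `p` totally
ramified in `K_∞/K` (here via `p ∤ h_K`, `AcSigned.Setting`). TRANSCRIBED for finite `m`
(TODO(general form): `m = ∞`, which is the statement on the discrete carriers) on the tree's
objects: the signed group `selmerTorsion … (fun _ ↦ .sgn ε) 0 m` EQUALS the classical `p^m`-Selmer
group `WeierstrassCurve.selmerTorsionOver (κ.layerSubgroup 0) (p^m)` of `E/K` (`κ.layerSubgroup 0 =
Γ_K`; both impose the same classical conditions away from `p`, flag `away-p`). This is the input
"`Sel_+(K, T) = Š_p(E/K)`" of Castella–Wan's descent (6.16) and Thm. 6.10 (MS p. 32), printed there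
for `p > 3`; Hatley–Lei–Vigni print it for odd `p`.
[cite: HatleyLeiVigni2022, Lemma 3.7 and §1.1–1.2] [cite: CastellaWan2023, §6.3 p. 32 (MS)] -/
def hatleyLeiVigni2022_lemma37_signedSelmerTorsion_zero : Prop :=
  ∀ (_ : Setting W K p κ 𝔭 𝔭') (N : ℕ), (W.conductorNorm ℤ : ℕ) = N → SatisfiesHeegnerHypothesis N K →
    ∀ (ε : ℤˣ) (m : ℕ),
      selmerTorsion (W.baseChange K) p κ (fun _ ↦ .sgn ε) 0 m =
        (W.baseChange K).selmerTorsionOver (κ.layerSubgroup 0) ((p : ℤ) ^ m)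

/-- **Hatley–Lei–Vigni 2022, Prop. 3.9 (the signed control theorem between finite layers).**
Printed: "Let `E/ℚ` be an elliptic curve satisfying (Tam). Let `m, m', n, n' ∈ ℕ ∪ {∞}` with
`m ≤ m'` and `n ≤ n'`. The restriction map induces an isomorphism of `Λ`-modules
`Sel^±_{p^m}(E/K_n) ≃ Sel^±_{p^{m'}}(E/K_{n'})[p^m]^{𝒢_{n'/n}}`", (Tam): "the prime `p` does not
divide `#(E/E⁰)`" (no Tamagawa number divisible by `p`); standing hypotheses as in
`hatleyLeiVigni2022_lemma37_signedSelmerTorsion_zero`. TRANSCRIBED for `m = m'` FINITE and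
`n ≤ n'` FINITE (TODO(general form): `m < m'` and the layers `∞`; the case `(m, n, n') = (∞, 0, ∞)`
is `AcSigned.hatleyLeiVigni2022_prop39_control_base`): the restriction
`res : H¹(K_n, E[p^m]) → H¹(K_{n'}, E[p^m])` (`resOfLe` along `Gal(K̄/K_{n'}) ≤ Gal(K̄/K_n)`) is
injective on `Sel^±_{p^m}(E/K_n)` and its image there is exactly the set of classes of
`Sel^±_{p^m}(E/K_{n'})` fixed by `conj_σ` for all `σ ∈ Gal(K̄/K_n)` (the `𝒢_{n'/n}`-invariants;
inner automorphisms act trivially). [cite: HatleyLeiVigni2022, Prop. 3.9, (Tam) and §1.1–1.2] -/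
def hatleyLeiVigni2022_prop39_control_layers : Prop :=
  ∀ (_ : Setting W K p κ 𝔭 𝔭') (N : ℕ), (W.conductorNorm ℤ : ℕ) = N → SatisfiesHeegnerHypothesis N K →
    ¬ p ∣ W.tamagawaProduct → ∀ (ε : ℤˣ) (m n n' : ℕ) (h : n ≤ n'),
    (∀ c ∈ selmerTorsion (W.baseChange K) p κ (fun _ ↦ .sgn ε) n m,
      resOfLe (geomTorsion (W.baseChange K) ((p : ℤ) ^ m)) (κ.layerSubgroup_antitone h) c = 0 →
        c = 0) ∧
    ∀ c' : (W.baseChange K).torsionH1Over ((p : ℤ) ^ m) (κ.layerSubgroup n'),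
      c' ∈ (selmerTorsion (W.baseChange K) p κ (fun _ ↦ .sgn ε) n m).map
          (resOfLe (geomTorsion (W.baseChange K) ((p : ℤ) ^ m)) (κ.layerSubgroup_antitone h)) ↔
        c' ∈ selmerTorsion (W.baseChange K) p κ (fun _ ↦ .sgn ε) n' m ∧
          ∀ σ ∈ κ.layerSubgroup n,
            conjH1 (κ.layerSubgroup n') (geomTorsion (W.baseChange K) ((p : ℤ) ^ m)) σ c' = c'

end Facts

end Literature.NumberTheory.EllipticCurves.AcSigned

end
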